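import Summits.BirchSwinnertonDyer.BirchSwinnertonDyer.Theorems.CumulativeHeegnerLeopoldtCumulativeHeegnerInclusionAtThreeLayerTowerSigma
import Summits.BirchSwinnertonDyer.BirchSwinnertonDyer.Theorems.CumulativeHeegnerLeopoldtCumulativeHeegnerInclusionAtThreeLayerTower
import HarnessLib

/-!
# Crux K1 `CumulativeHeegnerInclusionAtThree` (stmt-BirchSwinnertonDyer-24198) / crux A (stmt-26896): the
# port [P-ctl], V (door) — A and K1 BY NAME from the Σ-IMPRIMITIVE Fitting layer tower (LT^Σ), no control input

Width seat bsd-line-chl-k1-p1-w8 (`--supports stmt-BirchSwinnertonDyer-24198`). THEOREMS ONLY (no definition, no named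
fact, no `sorry`). DOOR file: imports the route's (LT) door `…LayerTower` (p637184, which imports the route file) and the
route-independent supplier `…LayerTowerSigma` ([P-ctl] I–V: exact layer control on the Leopoldt cell + dual packaging +
`Σ`-passage). Statements:

* **`temperedHeegnerInclusionAtThree_of_sigmaFittingLayerTower`** — A (`TemperedHeegnerInclusionAtThree`, crux 26896) BY NAME
  from (LT^Σ): at every frame of A, a finite `Σ ⊇ {bad v ∤ 3}`, a uniform `μ`, and at every layer `m` a layer element
  `θ_m ∈ Fitt_Λ(Hom(Sel_{𝔭′}^Σ(K_m, E[3^∞]), ℚ/ℤ))·R₀⟦T⟧` with `3^μ L ∈ (θ_m) + (3^m) + (ω_m)` (any presentation `(f, h)` of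
  the layer dual). NO control theorem, NO Tamagawa-type kernel is an input: control along the tower is EXACT on the cell.
* **`cumulativeHeegnerInclusionAtThree_of_print_of_sigmaFittingLayerTower`** — K1 BY NAME from P (print item 26897) ∧ (LT^Σ).

What (LT^Σ) still asks for is RESEARCH ([R-layer-KS]: an equivariant Kolyvagin-type bound of the Σ-imprimitive layer
Selmer groups by `θ_m`; [R-layer-rec]: the layer reciprocity `θ_m ≡ u·3^μ L`), neither in print at additive `3`. Crux A
(26896) and K1 (24198) stay OPEN; BSD is not proved by any of this; no summit statement is proved by this seat.

References: [GreenbergLNM1716] §3 p. 90; [MazurTate1987] §1; [KimKurihara2021] §1; [BertoliniDarmon1990] §2;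
[CastellaGrossiLeeSkinner2022] §1.2 Prop. 14 (arXiv:2008.02571).
-/

set_option linter.dupNamespace false
set_option autoImplicit false

noncomputable section

open scoped Classical

namespace Summit.BirchSwinnertonDyer.BirchSwinnertonDyer.Theorems.CumulativeHeegnerInclusionAtThreeLayerTowerSigmaDoor

open NumberField IsDedekindDomain Field
open Literature.NumberTheory.EllipticCurves
open Summit.BirchSwinnertonDyer.Rank1Residual.X11b Summit.BirchSwinnertonDyer.Rank1Residual.X11b.AcSelmer
open Summit.BirchSwinnertonDyer.BirchSwinnertonDyer.Theorems.CumulativeHeegnerInclusionAtThreeLayerTower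
open Summit.BirchSwinnertonDyer.BirchSwinnertonDyer.Theorems.CumulativeHeegnerInclusionAtThreeLayerTowerSigma

/-- **(LT^Σ) ⟹ A by name.** If at every frame of crux A there are a finite `Σ ⊇ {bad v ∤ 3}`, a uniform `μ`, and at every
layer `m` a presentation of the Σ-imprimitive layer dual `Hom(Sel_{𝔭′}^Σ(K_m, E[3^∞]), ℚ/ℤ)` carrying a layer element
`θ_m ∈ Fitt_Λ(·)·R₀⟦T⟧` with `3^μ L ∈ (θ_m) + (3^m) + (ω_m)` — the natural end of a layer-by-layer equivariant
Kolyvagin argument for the Σ-IMPRIMITIVE Selmer groups followed by a layer reciprocity — then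
`TemperedHeegnerInclusionAtThree` holds: control along the tower is EXACT on the cell (III), so NO Tamagawa-type input
is needed (§2 + the (LT) door). Nothing about the existence of such an argument at additive `3` is asserted.
[cite: KimKurihara2021, §1] [cite: BertoliniDarmon1990, §2] [cite: MazurTate1987, §1] -/
theorem temperedHeegnerInclusionAtThree_of_sigmaFittingLayerTower
    (hLT : ∀ (W : WeierstrassCurve ℚ) [W.IsElliptic] [W.IsGloballyMinimal] (N : ℕ) [NeZero N] (K : Type) [Field K] [NumberField K] (Dt : Literature.NumberTheory.EllipticCurves.ModularForms.ModularParametrizationData W N), Summit.BirchSwinnertonDyer.Rank1Residual.Additive.ClassO6 W 3 → Literature.NumberTheory.EllipticCurves.Rank1Residual.Red W 3 → (∃ Φ : AddSubgroup (WeierstrassCurve.geomTorsion W ((3 : ℕ) : ℤ)), Literature.NumberTheory.EllipticCurves.Rank1Residual.IsRationalLine W 3 Φ ∧ ∀ (v : IsDedekindDomain.HeightOneSpectrum (NumberField.RingOfIntegers ℚ)), ((3 : ℕ) : NumberField.RingOfIntegers ℚ) ∈ v.asIdeal → ∀ 𝔓 ∈ v.primesAbove, ¬ (∀ g ∈ 𝔓.decompositionSubgroup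 (Field.absoluteGaloisGroup ℚ), ∀ P ∈ Φ, g • P = P) ∧ ¬ (∀ g ∈ 𝔓.decompositionSubgroup (Field.absoluteGaloisGroup ℚ), ∀ P : WeierstrassCurve.geomTorsion W ((3 : ℕ) : ℤ), g • P - P ∈ Φ)) → W.analyticRank = 1 → W.conductorNorm ℤ = N → Literature.NumberTheory.EllipticCurves.IsImaginaryQuadratic K → Literature.NumberTheory.EllipticCurves.SatisfiesHeegnerHypothesis N K → ∀ (κ : Literature.NumberTheory.EllipticCurves.ZpExtension K 3), κ.IsAnticyclotomic → ∀ (γ : Field.absoluteGaloisGroup K) [Fact (κ.IsTopGenerator γ)] (𝔭 : IsDedekindDomain.HeightOneSpectrum (NumberField.RingOfIntegers K)), ((3 : ℕ) : NumberField.RingOfIntegers K) ∈ 𝔭.asIdeal → 𝔭.asIdeal.ramificationIdx (NumberField.RingOfIntegers ℚ) = 1 → 𝔭.asIdeal.inertiaDeg (NumberField.RingOfIntegers ℚ) = 1 → ∀ (𝔭' : IsDedekindDomain.HeightOneSpectrum (NumberField.RingOfIntegers K)), ((3 : ℕ) : NumberField.RingOfIntegers K) ∈ 𝔭'.asIdeal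 → 𝔭' ≠ 𝔭 → ∀ (ι' : PadicAlgCl 3 ≃+* ℂ), Summit.BirchSwinnertonDyer.BirchSwinnertonDyer.Theorems.SchneiderFree.BranchInducesPrime 3 ι' 𝔭 → ∀ (ΩK : ℂ) (Ωp : ℂ_[3]) (L : Literature.NumberTheory.EllipticCurves.UnrSeries 3), ΩK ≠ 0 → Ωp ≠ 0 → Literature.NumberTheory.EllipticCurves.IsBDPLFunction ι' 𝔭 κ γ Dt.f ΩK Ωp L →
      haveI : (W.baseChange K).IsElliptic := inferInstanceAs (W.map (algebraMap ℚ K)).IsElliptic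
      ∃ (S : Set (IsDedekindDomain.HeightOneSpectrum (NumberField.RingOfIntegers K))), S.Finite ∧
        (∀ v : IsDedekindDomain.HeightOneSpectrum (NumberField.RingOfIntegers K),
          ((3 : ℕ) : NumberField.RingOfIntegers K) ∉ v.asIdeal → ¬ (W.baseChange K).HasGoodReductionAt v → v ∈ S) ∧
        ∃ μ : ℕ, ∀ m : ℕ,
          ∃ (f : AddMonoid.End ↥(Summit.BirchSwinnertonDyer.Rank1Residual.X11b.AcSelmer.selmerOver (κ.layerSubgroup m)
              ((W.baseChange K).geomPrimaryTorsion 3) 3 𝔭' S))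
            (_ : ∀ s, ((f s : Summit.BirchSwinnertonDyer.Rank1Residual.X11b.AcSelmer.selmerOver (κ.layerSubgroup m)
              ((W.baseChange K).geomPrimaryTorsion 3) 3 𝔭' S) : (W.baseChange K).subgroupH1 3 (κ.layerSubgroup m)) =
                (W.baseChange K).conjH1 3 (κ.layerSubgroup m) γ s)
            (h : Literature.NumberTheory.EllipticCurves.IwasawaDual.IsLocNil 3 (f - 1))
            (θ : Literature.NumberTheory.EllipticCurves.UnrSeries 3),
            θ ∈ (Literature.RingTheory.FittingIdeal.Module.fittingIdeal (Literature.NumberTheory.EllipticCurves.IwasawaAlgebra 3)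
              (Summit.BirchSwinnertonDyer.BirchSwinnertonDyer.Theorems.BiquadraticEisensteinDescentDefs.LocNilDual
                (Summit.BirchSwinnertonDyer.Rank1Residual.X11b.AcSelmer.selmerOver (κ.layerSubgroup m)
                  ((W.baseChange K).geomPrimaryTorsion 3) 3 𝔭' S) f h) 0).map
                (PowerSeries.map (Summit.BirchSwinnertonDyer.Rank1Residual.X11b.Halves.toUnr 3)) ∧
            (3 : Literature.NumberTheory.EllipticCurves.UnrSeries 3) ^ μ * L ∈ Ideal.span {θ} ⊔
              Ideal.span {(3 : Literature.NumberTheory.EllipticCurves.UnrSeries 3) ^ m} ⊔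
              Ideal.span {((1 + PowerSeries.X) ^ (3 ^ m) - 1 : Literature.NumberTheory.EllipticCurves.UnrSeries 3)}) :
    Summit.BirchSwinnertonDyer.BirchSwinnertonDyer.Theses.CumulativeHeegnerLeopoldt.TemperedHeegnerInclusionAtThree := by
  refine temperedHeegnerInclusionAtThree_of_fittingLayerTower ?_
  intro W _ _ N _ K _ _ Dt hO6 hRed hcell hr hN hK hHg κ hκ γ _ 𝔭 h𝔭 he hf 𝔭' h𝔭' hne ι' hι ΩK Ωp L hΩK hΩp hBDP
  obtain ⟨S, hSfin, hbad, μ, hT⟩ :=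
    hLT W N K Dt hO6 hRed hcell hr hN hK hHg κ hκ γ 𝔭 h𝔭 he hf 𝔭' h𝔭' hne ι' hι ΩK Ωp L hΩK hΩp hBDP
  exact ⟨μ, cell_fittingLayerTower_of_sigmaLayerTower W N K hO6 hcell hN hK hHg κ γ 𝔭' h𝔭' S hSfin hbad μ L hT⟩

/-- **K1 ⟸ P ∧ (LT^Σ) by name**: the print input P (`ResidualSelmerPrintedInputAtThree`, CGLS22 Prop. 14, item 26897)
and the Σ-imprimitive Fitting layer tower give the route crux `CumulativeHeegnerInclusionAtThree`
(`…LayerTower.cumulativeHeegnerInclusionAtThree_of_print_of_fittingLayerTower` fed with §2).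
[cite: CastellaGrossiLeeSkinner2022, §1.2 Prop. 14 (arXiv:2008.02571)] [cite: MazurTate1987, §1] -/
theorem cumulativeHeegnerInclusionAtThree_of_print_of_sigmaFittingLayerTower
    (hP : Summit.BirchSwinnertonDyer.BirchSwinnertonDyer.Theses.CumulativeHeegnerLeopoldt.ResidualSelmerPrintedInputAtThree)
    (hLT : ∀ (W : WeierstrassCurve ℚ) [W.IsElliptic] [W.IsGloballyMinimal] (N : ℕ) [NeZero N] (K : Type) [Field K] [NumberField K] (Dt : Literature.NumberTheory.EllipticCurves.ModularForms.ModularParametrizationData W N), Summit.BirchSwinnertonDyer.Rank1Residual.Additive.ClassO6 W 3 → Literature.NumberTheory.EllipticCurves.Rank1Residual.Red W 3 → (∃ Φ : AddSubgroup (WeierstrassCurve.geomTorsion W ((3 : ℕ) : ℤ)), Literature.NumberTheory.EllipticCurves.Rank1Residual.IsRationalLine W 3 Φ ∧ ∀ (v : IsDedekindDomain.HeightOneSpectrum (NumberField.RingOfIntegers ℚ)), ((3 : ℕ) : NumberField.RingOfIntegers ℚ) ∈ v.asIdeal → ∀ 𝔓 ∈ v.primesAbove, ¬ (∀ g ∈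 𝔓.decompositionSubgroup (Field.absoluteGaloisGroup ℚ), ∀ P ∈ Φ, g • P = P) ∧ ¬ (∀ g ∈ 𝔓.decompositionSubgroup (Field.absoluteGaloisGroup ℚ), ∀ P : WeierstrassCurve.geomTorsion W ((3 : ℕ) : ℤ), g • P - P ∈ Φ)) → W.analyticRank = 1 → W.conductorNorm ℤ = N → Literature.NumberTheory.EllipticCurves.IsImaginaryQuadratic K → Literature.NumberTheory.EllipticCurves.SatisfiesHeegnerHypothesis N K → ∀ (κ : Literature.NumberTheory.EllipticCurves.ZpExtension K 3), κ.IsAnticyclotomic → ∀ (γ : Field.absoluteGaloisGroup K) [Fact (κ.IsTopGenerator γ)] (𝔭 : IsDedekindDomain.HeightOneSpectrum (NumberField.RingOfIntegers K)), ((3 : ℕ) : NumberField.RingOfIntegers K) ∈ 𝔭.asIdeal → 𝔭.asIdeal.ramificationIdx (NumberField.RingOfIntegers ℚ) = 1 → 𝔭.asIdeal.inertiaDeg (NumberField.RingOfIntegers ℚ) = 1 → ∀ (𝔭' : IsDedekindDomain.HeightOneSpectrum (NumberField.RingOfIntegers K)), ((3 : ℕ) : NumberField.RingOfIntegers K) ∈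 𝔭'.asIdeal → 𝔭' ≠ 𝔭 → ∀ (ι' : PadicAlgCl 3 ≃+* ℂ), Summit.BirchSwinnertonDyer.BirchSwinnertonDyer.Theorems.SchneiderFree.BranchInducesPrime 3 ι' 𝔭 → ∀ (ΩK : ℂ) (Ωp : ℂ_[3]) (L : Literature.NumberTheory.EllipticCurves.UnrSeries 3), ΩK ≠ 0 → Ωp ≠ 0 → Literature.NumberTheory.EllipticCurves.IsBDPLFunction ι' 𝔭 κ γ Dt.f ΩK Ωp L →
      haveI : (W.baseChange K).IsElliptic := inferInstanceAs (W.map (algebraMap ℚ K)).IsElliptic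
      ∃ (S : Set (IsDedekindDomain.HeightOneSpectrum (NumberField.RingOfIntegers K))), S.Finite ∧
        (∀ v : IsDedekindDomain.HeightOneSpectrum (NumberField.RingOfIntegers K),
          ((3 : ℕ) : NumberField.RingOfIntegers K) ∉ v.asIdeal → ¬ (W.baseChange K).HasGoodReductionAt v → v ∈ S) ∧
        ∃ μ : ℕ, ∀ m : ℕ,
          ∃ (f : AddMonoid.End ↥(Summit.BirchSwinnertonDyer.Rank1Residual.X11b.AcSelmer.selmerOver (κ.layerSubgroup m)
              ((W.baseChange K).geomPrimaryTorsion 3) 3 𝔭' S))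
            (_ : ∀ s, ((f s : Summit.BirchSwinnertonDyer.Rank1Residual.X11b.AcSelmer.selmerOver (κ.layerSubgroup m)
              ((W.baseChange K).geomPrimaryTorsion 3) 3 𝔭' S) : (W.baseChange K).subgroupH1 3 (κ.layerSubgroup m)) =
                (W.baseChange K).conjH1 3 (κ.layerSubgroup m) γ s)
            (h : Literature.NumberTheory.EllipticCurves.IwasawaDual.IsLocNil 3 (f - 1))
            (θ : Literature.NumberTheory.EllipticCurves.UnrSeries 3),
            θ ∈ (Literature.RingTheory.FittingIdeal.Module.fittingIdeal (Literature.NumberTheory.EllipticCurves.IwasawaAlgebra 3)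
              (Summit.BirchSwinnertonDyer.BirchSwinnertonDyer.Theorems.BiquadraticEisensteinDescentDefs.LocNilDual
                (Summit.BirchSwinnertonDyer.Rank1Residual.X11b.AcSelmer.selmerOver (κ.layerSubgroup m)
                  ((W.baseChange K).geomPrimaryTorsion 3) 3 𝔭' S) f h) 0).map
                (PowerSeries.map (Summit.BirchSwinnertonDyer.Rank1Residual.X11b.Halves.toUnr 3)) ∧
            (3 : Literature.NumberTheory.EllipticCurves.UnrSeries 3) ^ μ * L ∈ Ideal.span {θ} ⊔
              Ideal.span {(3 : Literature.NumberTheory.EllipticCurves.UnrSeries 3) ^ m} ⊔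
              Ideal.span {((1 + PowerSeries.X) ^ (3 ^ m) - 1 : Literature.NumberTheory.EllipticCurves.UnrSeries 3)}) :
    Summit.BirchSwinnertonDyer.BirchSwinnertonDyer.Theses.CumulativeHeegnerLeopoldt.CumulativeHeegnerInclusionAtThree := by
  refine cumulativeHeegnerInclusionAtThree_of_print_of_fittingLayerTower hP ?_
  intro W _ _ N _ K _ _ Dt hO6 hRed hcell hr hN hK hHg κ hκ γ _ 𝔭 h𝔭 he hf 𝔭' h𝔭' hne ι' hι ΩK Ωp L hΩK hΩp hBDP
  obtain ⟨S, hSfin, hbad, μ, hT⟩ :=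
    hLT W N K Dt hO6 hRed hcell hr hN hK hHg κ hκ γ 𝔭 h𝔭 he hf 𝔭' h𝔭' hne ι' hι ΩK Ωp L hΩK hΩp hBDP
  exact ⟨μ, cell_fittingLayerTower_of_sigmaLayerTower W N K hO6 hcell hN hK hHg κ γ 𝔭' h𝔭' S hSfin hbad μ L hT⟩

end Summit.BirchSwinnertonDyer.BirchSwinnertonDyer.Theorems.CumulativeHeegnerInclusionAtThreeLayerTowerSigmaDoor

end
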